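import Literature.Geometry.Kaehler.ComplexTorusHodgeDecomposition
import Literature.Geometry.Kaehler.ComplexTorusLatticeMonomials
import Literature.Geometry.Kaehler.ComplexTorusMaps
import HarnessLib

/-!
# The complex torus `ℂ²/(ℤ + τℤ)²` of the square of an elliptic curve and its Weil forms

De Rham side of the construction of a **Weil-type abelian surface for every `ℚ(√-d)`** (the named
fact `Literature.AlgebraicGeometry.HodgeTheory.exists_weilType_abelianSurfaces`, Schoen, Compositio
114 (1998) §10; van Geemen, LNM 1594, 5.3): on `B = E × E`, `E = ℂ/(ℤ + τℤ)` ANY elliptic curve,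
the companion endomorphism `ψ(u₀, u₁) = (-d u₁, u₀)` (the companion matrix of `T² + d`) satisfies
`ψ² = -d`, and for every test endomorphism `x + yψ` (`x, y ∈ ℤ`), acting on `ℂ²` by the `ℂ`-linear
map `M(u₀, u₁) = (x u₀ - d y u₁, y u₀ + x u₁)` (`WeilSquare.weilLin`), the invariant `2`-forms
`α_s = (du₀ + s du₁) ∧ (dū₀ + s dū₁)`, `s = ± i√d` (`WeilSquare.weilForm`), satisfy
`M^* α_s = (x + ys)² α_s` (`weilForm_compContinuousLinearMap_weilLin`), are of type `(1,1)`
(`isConstOfType_weilForm`), and `α_{i√d} + α_{-i√d} = 2(τ̄ - τ)(dx₀ ∧ dx₁ - d · dx₂ ∧ dx₃)` is a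
multiple of a RATIONAL combination of lattice monomials (`weilForm_add_weilForm_neg`; lattice
coordinates `x₀, …, x₃` of the period isomorphism `WeilSquare.periodIso τ : ℝ⁴ ≃ ℂ²`,
`x ↦ (x₀ + τx₁, x₂ + τx₃)`, Lange–Birkenhake (1992) §1.1.1). The integer matrix of `M` in the
lattice basis is `WeilSquare.weilMatrix` (`realRep_weilMatrix`), so that `M` descends to the torus
`WeilSquare.Torus τ = ComplexTorus (periodIso τ)` as `ComplexTorus.mapMatrix`. Everything here is
linear algebra on `ℂ²`; the algebraic model `E × E` and the comparison with singular cohomology are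
in the companion files `WeilSurfaceSquareModel`, `WeilSurfaceSquareRational`, `WeilClassesSurfacesProofs`.

## References

* C. Schoen, *Addendum to: Hodge classes on self-products of a variety with an automorphism*,
  Compositio Math. 114 (1998), §10. [Schoen1998HodgeWeilAddendum]
* B. van Geemen, *An introduction to the Hodge conjecture for abelian varieties*, LNM 1594 (1994),
  5.2–5.3. [vanGeemen1994HodgeAV]
* H. Lange, Ch. Birkenhake, *Complex Abelian Varieties* (1992), §1.1.1–§1.1.5. [LangeBirkenhake1992]
-/

noncomputable section

open scoped ComplexConjugate Manifold ContDiff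
open Literature.Geometry.Kaehler Literature.LinearAlgebra.Alternating

namespace Literature.AlgebraicGeometry.HodgeTheory

namespace WeilSquare

/-! ### The period isomorphism of `(ℤ + τℤ)² ⊂ ℂ²` -/

/-- The real-linear period map `x ↦ (x₀ + τx₁, x₂ + τx₃) : ℝ⁴ → ℂ²` (period matrix `(𝟙, τ𝟙)`).
[cite: LangeBirkenhake1992, §1.1.1] -/
def periodMapLin (τ : ℂ) : (Fin 4 → ℝ) →ₗ[ℝ] (Fin 2 → ℂ) where
  toFun x := ![(x 0 : ℂ) + τ * x 1, (x 2 : ℂ) + τ * x 3]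
  map_add' x y := by
    funext a
    fin_cases a <;> (simp only [Pi.add_apply, Complex.ofReal_add]; simp; ring)
  map_smul' c x := by
    funext a
    fin_cases a <;>
      (simp only [Pi.smul_apply, smul_eq_mul, Complex.ofReal_mul, RingHom.id_apply, Complex.real_smul];
        simp; ring)

/-- The inverse: lattice coordinates `x_{2a+1} = Im z_a / Im τ`, `x_{2a} = Re z_a - Re τ · Im z_a / Im τ`.
[cite: LangeBirkenhake1992, §1.1.4] -/
def periodInv (τ : ℂ) (z : Fin 2 → ℂ) : Fin 4 → ℝ :=
  ![(z 0).re - τ.re * (z 0).im / τ.im, (z 0).im / τ.im, (z 1).re - τ.re * (z 1).im / τ.im, (z 1).im / τ.im]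

variable (τ : ℂ) (hτ : τ.im ≠ 0)

/-- **The period isomorphism** `Φ_τ : ℝ⁴ ≃ ℂ²` of the lattice `(ℤ + τℤ)²`, `Im τ ≠ 0`.
[cite: LangeBirkenhake1992, §1.1.1] -/
def periodIso : (Fin 4 → ℝ) ≃L[ℝ] (Fin 2 → ℂ) :=
  LinearEquiv.toContinuousLinearEquiv
    { periodMapLin τ with
      invFun := periodInv τ
      left_inv := fun x ↦ by
        funext p
        fin_cases p <;> (simp [periodMapLin, periodInv]; field_simp) <;> ring
      right_inv := fun z ↦ by
        funext a
        fin_cases a <;> (apply Complex.ext <;> (simp [periodMapLin, periodInv]; field_simp)) <;> ring }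

/-- First component of the period isomorphism. [cite: LangeBirkenhake1992, §1.1.1] -/
@[simp] theorem periodIso_apply_zero (x : Fin 4 → ℝ) : periodIso τ hτ x 0 = (x 0 : ℂ) + τ * x 1 := rfl

/-- Second component of the period isomorphism. [cite: LangeBirkenhake1992, §1.1.1] -/
@[simp] theorem periodIso_apply_one (x : Fin 4 → ℝ) : periodIso τ hτ x 1 = (x 2 : ℂ) + τ * x 3 := rfl

/-- **The complex torus `ℂ²/(ℤ + τℤ)²`**, analytically `E_τ × E_τ`: a compact complex surface charted
on `ℂ²`. [cite: LangeBirkenhake1992, §1.1.1] -/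
abbrev Torus : Type := ComplexTorus (periodIso τ hτ)

/-! ### The test endomorphisms `x + yψ` on `ℂ²` and their integer matrices -/

/-- The `ℂ`-linear map `M(u₀, u₁) = (x u₀ - d y u₁, y u₀ + x u₁)` of `ℂ²`: the analytic
representation of `x + yψ` for the companion endomorphism `ψ(u₀, u₁) = (-d u₁, u₀)` of `E × E`.
[cite: Schoen1998HodgeWeilAddendum, §10] -/
def weilLin (d x y : ℤ) : (Fin 2 → ℂ) →L[ℂ] (Fin 2 → ℂ) where
  toFun u := ![(x : ℂ) * u 0 - d * y * u 1, (y : ℂ) * u 0 + x * u 1]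
  map_add' u v := by funext a; fin_cases a <;> (simp; ring)
  map_smul' c u := by funext a; fin_cases a <;> (simp; ring)
  cont := continuous_pi fun a ↦ by fin_cases a <;> simp <;> fun_prop

/-- First component of `weilLin`. [folklore] -/
@[simp] theorem weilLin_apply_zero (d x y : ℤ) (u : Fin 2 → ℂ) :
    weilLin d x y u 0 = (x : ℂ) * u 0 - d * y * u 1 := rfl

/-- Second component of `weilLin`. [folklore] -/
@[simp] theorem weilLin_apply_one (d x y : ℤ) (u : Fin 2 → ℂ) :
    weilLin d x y u 1 = (y : ℂ) * u 0 + x * u 1 := rfl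

/-- **The integer matrix of `x + yψ` in the lattice basis** `(e₀, τe₀, e₁, τe₁)` (its rational
representation, Lange–Birkenhake §1.1.2): `M` acts blockwise by `((x, -dy), (y, x))`.
[cite: LangeBirkenhake1992, §1.1.2] -/
def weilMatrix (d x y : ℤ) : Matrix (Fin 4) (Fin 4) ℤ :=
  !![x, 0, -(d * y), 0; 0, x, 0, -(d * y); y, 0, x, 0; 0, y, 0, x]

/-- `Φ_τ (A x) = M (Φ_τ x)` for `A = weilMatrix`, `M = weilLin`: the lattice `(ℤ + τℤ)²` is stable
under `M`. [cite: LangeBirkenhake1992, §1.1.2] -/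
theorem periodIso_mulVec_weilMatrix (d x y : ℤ) (v : Fin 4 → ℝ) :
    periodIso τ hτ (((weilMatrix d x y).map (Int.cast : ℤ → ℝ)).mulVec v) = weilLin d x y (periodIso τ hτ v) := by
  funext a
  fin_cases a
  · rw [show ((⟨0, by norm_num⟩ : Fin 2)) = 0 from rfl, periodIso_apply_zero, weilLin_apply_zero,
      periodIso_apply_zero, periodIso_apply_one]
    simp [weilMatrix, Matrix.mulVec, dotProduct, Fin.sum_univ_four]
    ring
  · rw [show ((⟨1, by norm_num⟩ : Fin 2)) = 1 from rfl, periodIso_apply_one, weilLin_apply_one,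
      periodIso_apply_zero, periodIso_apply_one]
    simp [weilMatrix, Matrix.mulVec, dotProduct, Fin.sum_univ_four]
    ring

/-- **The real analytic representation of `mapMatrix (weilMatrix d x y)` is `M`.**
[cite: LangeBirkenhake1992, §1.1.2] -/
theorem realRep_weilMatrix (d x y : ℤ) :
    ComplexTorus.realRep (periodIso τ hτ) (periodIso τ hτ) (weilMatrix d x y) =
      (weilLin d x y : (Fin 2 → ℂ) →L[ℂ] (Fin 2 → ℂ)).restrictScalars ℝ := by
  ext1 u
  have h := ComplexTorus.realRep_apply (Φ := periodIso τ hτ) (Φ' := periodIso τ hτ) (weilMatrix d x y)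
    ((periodIso τ hτ).symm u)
  rw [ContinuousLinearEquiv.apply_symm_apply] at h
  rw [h, periodIso_mulVec_weilMatrix, ContinuousLinearEquiv.apply_symm_apply]
  rfl

/-- The endomorphism `x + yψ` of the torus is holomorphic (its analytic representation is `ℂ`-linear).
[cite: LangeBirkenhake1992, §1.1.2] -/
theorem contMDiff_mapMatrix_weilMatrix (d x y : ℤ) :
    ContMDiff 𝓘(ℂ, Fin 2 → ℂ) 𝓘(ℂ, Fin 2 → ℂ) ω
      (ComplexTorus.mapMatrix (periodIso τ hτ) (periodIso τ hτ) (weilMatrix d x y)) :=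
  ComplexTorus.contMDiff_mapMatrix (weilLin d x y) (periodIso_mulVec_weilMatrix τ hτ d x y)

/-! ### The Weil forms `α_s = (du₀ + s du₁) ∧ (dū₀ + s dū₁)` -/

/-- `ℓ_s(u) = u₀ + s u₁`, a `ℂ`-linear functional seen as real-linear. [cite: vanGeemen1994HodgeAV, 5.2] -/
def linForm (s : ℂ) : (Fin 2 → ℂ) →L[ℝ] ℂ :=
  ((ContinuousLinearMap.proj (R := ℂ) (φ := fun _ : Fin 2 ↦ ℂ) 0) +
    s • ContinuousLinearMap.proj (R := ℂ) (φ := fun _ : Fin 2 ↦ ℂ) 1).restrictScalars ℝ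

/-- `ℓ_s(u) = u₀ + s u₁`. [folklore] -/
@[simp] theorem linForm_apply (s : ℂ) (u : Fin 2 → ℂ) : linForm s u = u 0 + s * u 1 := rfl

/-- `m_s(u) = ū₀ + s ū₁`, a conjugate-linear functional seen as real-linear. [cite: vanGeemen1994HodgeAV, 5.2] -/
def conjForm (s : ℂ) : (Fin 2 → ℂ) →L[ℝ] ℂ :=
  Complex.conjCLE.toContinuousLinearMap.comp
      ((ContinuousLinearMap.proj (R := ℂ) (φ := fun _ : Fin 2 ↦ ℂ) 0).restrictScalars ℝ) +
    s • Complex.conjCLE.toContinuousLinearMap.comp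
      ((ContinuousLinearMap.proj (R := ℂ) (φ := fun _ : Fin 2 ↦ ℂ) 1).restrictScalars ℝ)

/-- `m_s(u) = ū₀ + s ū₁`. [folklore] -/
@[simp] theorem conjForm_apply (s : ℂ) (u : Fin 2 → ℂ) : conjForm s u = conj (u 0) + s * conj (u 1) := rfl

/-- A real-linear functional as a `1`-form. [folklore] -/
def dOne (f : (Fin 2 → ℂ) →L[ℝ] ℂ) : (Fin 2 → ℂ) [⋀^Fin 1]→L[ℝ] ℂ :=
  ContinuousAlternatingMap.ofSubsingleton ℝ (Fin 2 → ℂ) ℂ (0 : Fin 1) f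

/-- `dOne f (v) = f (v 0)`. [folklore] -/
@[simp] theorem dOne_apply (f : (Fin 2 → ℂ) →L[ℝ] ℂ) (v : Fin 1 → (Fin 2 → ℂ)) : dOne f v = f (v 0) := rfl

/-- **The Weil form** `α_s = ℓ_s ∧ m_s = (du₀ + s du₁) ∧ (dū₀ + s dū₁)`, a constant complex-valued
real `2`-form on `ℂ²`; for `s = ± i√d` these span `⋀²` of the two eigenspaces of `ψ^*` on `H¹`
(van Geemen 5.2: `W_K ⊗ ℂ = ⋀^{2n} H¹_σ ⊕ ⋀^{2n} H¹_σ̄`, here `n = 1`). [cite: vanGeemen1994HodgeAV, 5.2] -/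
def weilForm (s : ℂ) : (Fin 2 → ℂ) [⋀^Fin 2]→L[ℝ] ℂ := (dOne (linForm s)).wedge (dOne (conjForm s))

/-- **Evaluation of the Weil form**: `α_s(v, w) = ℓ_s(v) m_s(w) - ℓ_s(w) m_s(v)`. [folklore] -/
theorem weilForm_apply (s : ℂ) (v : Fin 2 → (Fin 2 → ℂ)) :
    weilForm s v = (v 0 0 + s * v 0 1) * (conj (v 1 0) + s * conj (v 1 1)) -
      (v 1 0 + s * v 1 1) * (conj (v 0 0) + s * conj (v 0 1)) := by
  rw [weilForm, ContinuousAlternatingMap.wedge_apply_one_one]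
  simp

/-- **`α_s` has type `(1, 1)`**: `α_s(e^{iθ}v, e^{iθ}w) = α_s(v, w)` (`ℓ_s` has weight `1`, `m_s`
weight `-1`). [cite: LangeBirkenhake1992, §1.1.5] -/
theorem isConstOfType_weilForm (s : ℂ) : ComplexTorus.IsConstOfType (k := 2) 1 1 (weilForm s) := by
  refine ⟨rfl, fun θ v ↦ ?_⟩
  rw [weilForm_apply, weilForm_apply]
  have h : (starRingEnd ℂ) (Complex.exp (θ * Complex.I)) * Complex.exp (θ * Complex.I) = 1 := by
    rw [← Complex.exp_conj, ← Complex.exp_add]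
    simp [Complex.conj_ofReal]
  simp only [Pi.smul_apply, smul_eq_mul, map_mul, Nat.cast_one, sub_self, Int.cast_zero, zero_mul,
    Complex.exp_zero, one_mul]
  linear_combination ((v 0 0 + s * v 0 1) * (conj (v 1 0) + s * conj (v 1 1)) -
      (v 1 0 + s * v 1 1) * (conj (v 0 0) + s * conj (v 0 1))) * h

/-- `ℓ_s ∘ M = (x + ys) ℓ_s` for `s² = -d`. [cite: vanGeemen1994HodgeAV, 5.2] -/
theorem linForm_weilLin (d x y : ℤ) {s : ℂ} (hs : s * s = -d) (u : Fin 2 → ℂ) :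
    linForm s (weilLin d x y u) = ((x : ℂ) + y * s) * linForm s u := by
  simp only [linForm_apply, weilLin_apply_zero, weilLin_apply_one]
  linear_combination (-(y : ℂ) * u 1) * hs

/-- `m_s ∘ M = (x + ys) m_s` for `s² = -d` (`x, y, d` are real). [cite: vanGeemen1994HodgeAV, 5.2] -/
theorem conjForm_weilLin (d x y : ℤ) {s : ℂ} (hs : s * s = -d) (u : Fin 2 → ℂ) :
    conjForm s (weilLin d x y u) = ((x : ℂ) + y * s) * conjForm s u := by
  simp only [conjForm_apply, weilLin_apply_zero, weilLin_apply_one, map_sub, map_add, map_mul,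
    map_intCast]
  linear_combination (-(y : ℂ) * conj (u 1)) * hs

/-- **`M^* α_s = (x + ys)² α_s`** for `s² = -d` and `M = weilLin d x y`: the Weil forms are
eigenforms of every `x + yψ` with the eigenvalues `(x + iy√d)²`, `(x - iy√d)²`. [cite: vanGeemen1994HodgeAV, 5.2] -/
theorem weilForm_compContinuousLinearMap_weilLin (d x y : ℤ) {s : ℂ} (hs : s * s = -d) :
    (weilForm s).compContinuousLinearMap
        ((weilLin d x y : (Fin 2 → ℂ) →L[ℂ] (Fin 2 → ℂ)).restrictScalars ℝ) =
      ((x : ℂ) + y * s) ^ 2 • weilForm s := by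
  ext v
  rw [ContinuousAlternatingMap.compContinuousLinearMap_apply, ContinuousAlternatingMap.smul_apply]
  change weilForm s (fun i ↦ weilLin d x y (v i)) = _
  rw [weilForm, ContinuousAlternatingMap.wedge_apply_one_one, ContinuousAlternatingMap.wedge_apply_one_one]
  simp only [dOne_apply, Matrix.cons_val_fin_one, linForm_weilLin d x y hs, conjForm_weilLin d x y hs,
    smul_eq_mul]
  ring

/-! ### The Weil forms in lattice coordinates -/

/-- **Evaluation of a lattice `2`-monomial**: `(dx_a ∧ dx_b ∧ 1)(v, w) = x_a(v) x_b(w) - x_a(w) x_b(v)`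
(the `2 × 2` determinant of `wedgeWord_apply`). [cite: LangeBirkenhake1992, §1.1.4 Prop. 1.1.20] -/
theorem latMonomial_two_apply {ι E : Type*} [NormedAddCommGroup E] [NormedSpace ℂ E]
    (Φ : (ι → ℝ) ≃L[ℝ] E) (a b : ι) (v : Fin 2 → E) :
    ComplexTorus.latMonomial Φ 2 ![a, b] v =
      ((Φ.symm (v 0) a * Φ.symm (v 1) b - Φ.symm (v 1) a * Φ.symm (v 0) b : ℝ) : ℂ) := by
  rw [ComplexTorus.latMonomial_eq, wedgeWord_apply, Matrix.det_fin_two]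
  simp only [pairingMatrix_apply, Matrix.cons_val_zero, Matrix.cons_val_one,
    ContinuousLinearMap.smulRight_apply, ComplexTorus.coord_apply,
    ContinuousAlternatingMap.constOfIsEmpty_apply, Complex.real_smul, mul_one]
  push_cast
  ring

/-- **The rational avatar of the Weil plane**: `α_{s} + α_{-s} = 2(τ̄ - τ) · (dx₀ ∧ dx₁ - d · dx₂ ∧ dx₃)`
for `s² = -d` — the sum of the two Weil forms is a (transcendental) multiple of a RATIONAL combination
of lattice monomials (on `E × E` it is the class `[o × E] - d [E × o]`). [cite: Schoen1998HodgeWeilAddendum, §10] -/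
theorem weilForm_add_weilForm_neg (d : ℤ) {s : ℂ} (hs : s * s = -d) :
    weilForm s + weilForm (-s) = (2 * (conj τ - τ)) •
      (ComplexTorus.latMonomial (periodIso τ hτ) 2 ![0, 1] -
        (d : ℂ) • ComplexTorus.latMonomial (periodIso τ hτ) 2 ![2, 3]) := by
  ext v
  rw [ContinuousAlternatingMap.add_apply, ContinuousAlternatingMap.smul_apply,
    ContinuousAlternatingMap.sub_apply, ContinuousAlternatingMap.smul_apply, weilForm_apply,
    weilForm_apply, latMonomial_two_apply, latMonomial_two_apply]
  set p := (periodIso τ hτ).symm (v 0) with hp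
  set q := (periodIso τ hτ).symm (v 1) with hq
  have h0 : v 0 = periodIso τ hτ p := by rw [hp, ContinuousLinearEquiv.apply_symm_apply]
  have h1 : v 1 = periodIso τ hτ q := by rw [hq, ContinuousLinearEquiv.apply_symm_apply]
  rw [h0, h1]
  simp only [periodIso_apply_zero, periodIso_apply_one, map_add, map_mul, Complex.conj_ofReal,
    smul_eq_mul]
  push_cast
  linear_combination (2 * ((starRingEnd ℂ) τ - τ) * (↑(p 2) * ↑(q 3) - ↑(p 3) * ↑(q 2))) * hs

/-! ### On the torus -/

/-- **The class of `α_s` lies in `H^{1,1}(ℂ²/(ℤ + τℤ)²)`** (Lange–Birkenhake Thm. 1.1.21: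
`IF^{1,1} ⊆ H^{1,1}`). [cite: LangeBirkenhake1992, §1.1.5 Thm. 1.1.21] -/
theorem cconstClass_weilForm_mem_hodgePQ (s : ℂ) :
    ComplexTorus.cconstClass (periodIso τ hτ) (weilForm s) ∈
      Literature.NumberTheory.Transcendental.hodgePQ (Fin 2 → ℂ) (Torus τ hτ) 2 1 1 :=
  ComplexTorus.cconstClass_mem_hodgePQ (periodIso τ hτ) (isConstOfType_weilForm s)

/-- **`(x + yψ)^* [α_s] = (x + ys)² [α_s]`** in `H²_dR(ℂ²/(ℤ + τℤ)²; ℂ)` for `s² = -d`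
(`cmap_cconstClass_mapMatrix` and `realRep_weilMatrix`). [cite: vanGeemen1994HodgeAV, 5.2] -/
theorem cmap_cconstClass_weilForm (d x y : ℤ) {s : ℂ} (hs : s * s = -d) :
    Literature.NumberTheory.Transcendental.complexDeRhamCohomology.map (Fin 2 → ℂ)
        (ComplexTorus.contMDiff_real_mapMatrix (Φ := periodIso τ hτ) (Φ' := periodIso τ hτ) (n := ∞)
          (weilMatrix d x y)) 2
        (ComplexTorus.cconstClass (periodIso τ hτ) (weilForm s)) =
      ((x : ℂ) + y * s) ^ 2 • ComplexTorus.cconstClass (periodIso τ hτ) (weilForm s) := by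
  rw [ComplexTorus.cmap_cconstClass_mapMatrix, realRep_weilMatrix,
    weilForm_compContinuousLinearMap_weilLin d x y hs, map_smul]

end WeilSquare

end Literature.AlgebraicGeometry.HodgeTheory

end
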